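import Summits.HodgeConjecture.HodgeConjecture.Theorems.Ring2AbelianAllAndreLiebermanFourier
import Summits.HodgeConjecture.HodgeConjecture.Theorems.Ring2AbelianAllAndreLiebermanCorrespondenceAlgebra
import Literature.AlgebraicGeometry.HodgeTheory.LefschetzStandardUnconditionalDegrees
import Literature.AlgebraicGeometry.HodgeTheory.LefschetzStandardConjectureFacts
import Mathlib.LinearAlgebra.Charpoly.Basic
import HarnessLib

/-!
# Ring 2 · sub-cell AbelianAll, André axis, part XXII-c — LIEBERMAN'S THEOREM `B(A)` FOR COMPLEX ABELIAN VARIETIES,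
# PROVED ON THE REAL CARRIERS: the named fact `Lieberman1968_lefschetzInvolution_algebraic_abelianVariety` DISCHARGED

HONEST FRAMING (page 1, verbatim): **research route, not a corollary; conditional on HC_CM plus one named
minimal statement.** Cell line: research route conditional on HC_CM; not a corollary; Q11.4-sentence-2
already refuted in dim ≥ 3. Nothing in this file proves a case of the Hodge conjecture; `HC_CM` does not occur.
Seat `pub-hodge-ring2-ab-andre-2`, gen 14; brief (iii): "B for abelian varieties themselves is KNOWN —
Lieberman/Kleiman". Until this part the André axis carried Lieberman's theorem as the Literature NAMED FACT
`hL := Lieberman1968_lefschetzInvolution_algebraic_abelianVariety` (binder of parts XVIII-e, XXI-c, of ab-andre-1's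
`StandardAPencils`, of `LefschetzPencils`, and the source of the derived Abdulali facts `h₈A`, `h₈`). THIS FILE PROVES IT:

**`lieberman1968_lefschetzInvolution_algebraic_abelianVariety_holds :
    Lieberman1968_lefschetzInvolution_algebraic_abelianVariety`** — for every complex abelian variety `A` and every
`η ∈ H²(A(ℂ); ℂ)`, André's `⋆_L`-form of Grothendieck's `B(A)` on the real carriers (`StandardConjectureBStar A.dim A.X η`:
for a polarisation class `η` and all `a + b = 2 dim A`, the Lefschetz involution `*_L : Hᵃ(A(ℂ); ℂ) → Hᵇ(A(ℂ); ℂ)` is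
induced by an algebraic class on `A × A`).

## The argument (Kleiman, Dix exposés, Appendix to §2, 2A11; Lieberman, Amer. J. Math. 90 (1968))

By the tree's `standardConjectureBStar_iff_inverseLefschetz` only the degrees `a > g = dim A`, `b = 2g − a ≥ 2` matter,
where `*_L = (L^{g-b})⁻¹ : H^{b + 2(g-b)} → Hᵇ`. Part XXII-a: an algebraic class `γ_F` on `A × A` whose action
`F = [γ_F]_* : H^{b+2(g-b)}(A(ℂ)) → Hᵇ(A(ℂ))` is BIJECTIVE (the Fourier / Poincaré-class correspondence `± ℓ^b`; COR-CM row
M22 on the rational carriers). Part XXII-b: `w := F ∘ L^{g-b}` is again an algebraic correspondence `[γ_w]_*` (Lefschetz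
twist), an AUTOMORPHISM of `Hᵇ(A(ℂ); ℂ)`; by Cayley–Hamilton (§1: the minimal polynomial of an injective endomorphism has
non-zero constant term, Mathlib `LinearMap.minpoly_coeff_zero_of_injective`) `w⁻¹ = Σ_k d_k wᵏ`, so
`θ := (Σ_k d_k wᵏ) ∘ F = [γ_θ]_*` with `γ_θ` algebraic (composition of algebraic correspondences, part XXII-b:
Fulton 16.1.1 with the tree's Gysin base change and Voisin II Prop. 9.20, both theorems of the tree); and
`θ ∘ L^{g-b} = w⁻¹ ∘ w = id`, i.e. `θ = (L^{g-b})⁻¹ = *_L` on `H^{b+2(g-b)}` (hard Lefschetz: `L^{g-b}` is onto).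

## What is proved (theorems only; no definition, no NEW named fact, no sorry; net debt of the axis −1)

§1 `exists_sum_smul_pow_comp_eq_id` (inverse of an injective endomorphism of a finite-dimensional space as a polynomial).
§2 **`isAlgebraicCorrespondence_lefschetzInvolution_abelianVariety`** (the degrees `a > g`, `b ≥ 2`).
§3 **`standardConjectureBStar_abelianVariety`** (every `A`, every `η`), **`lieberman1968_lefschetzInvolution_algebraic_abelianVariety_holds`**.

EDGE LABELS: all K (kernel). For the census: the fact `Lieberman1968_lefschetzInvolution_algebraic_abelianVariety`
becomes DERIVED (tree theorem); every `K[hL]` row of RING2-MAP §AbelianAll (AA2.80, AA2.105) is now `K`; part XXII-d feeds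
the theorem into the `_of_lieberman` rows by name. References: Kleiman1968AlgebraicCycles (App. to §2, Thm. 2A11,
2A8–2A10); Lieberman1968 (main theorem, pp. 366–374); Kleiman1994 (4.3); GreenMurreVoisin1994 (Murre §7.7);
Voisin2025 (§3.2.2); Andre1996Motifs (§0.2–0.3, Prop. 1.2); Grothendieck1968 (§3 p. 196).
-/

noncomputable section

set_option linter.dupNamespace false

namespace Summit.HodgeConjecture.HodgeConjecture.Ring2.AbelianAll

open CategoryTheory AlgebraicGeometry MonoidalCategory CartesianMonoidalCategory
open Literature.AlgebraicGeometry Literature.AlgebraicGeometry.Motives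
open Literature.AlgebraicGeometry.HodgeTheory
open Literature.Geometry.Kaehler (lefschetzPow HasHardLefschetzProperty)
open Polynomial

/-! ## §1 Cayley–Hamilton: the inverse of an injective endomorphism is a polynomial in it -/

/-- **The inverse of an injective endomorphism of a finite-dimensional vector space is a polynomial in it**: there are
finitely many coefficients `d_k` with `(Σ_k d_k wᵏ) ∘ w = id`. (The minimal polynomial `p` of `w` has `p(0) ≠ 0` —
Mathlib `LinearMap.minpoly_coeff_zero_of_injective` — and `p = X q + p(0)`, so `q(w) ∘ w = −p(0)`.) This is the linear
algebra of Kleiman's 2A11 ("`θ` is a polynomial in the algebraic automorphism `w = F L^r`, hence algebraic").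
[cite: Kleiman1968AlgebraicCycles, Appendix to §2, proof of Thm. 2A11] -/
theorem exists_sum_smul_pow_comp_eq_id {V : Type*} [AddCommGroup V] [Module ℂ V] [FiniteDimensional ℂ V]
    (w : V →ₗ[ℂ] V) (hw : Function.Injective w) :
    ∃ (s : Finset ℕ) (d : ℕ → ℂ), (∑ k ∈ s, d k • w ^ k) ∘ₗ w = LinearMap.id := by
  set p := minpoly ℂ w with hp
  have hp0 : p.coeff 0 ≠ 0 := LinearMap.minpoly_coeff_zero_of_injective hw
  have heval : aeval w p = 0 := minpoly.aeval ℂ w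
  -- `p = q X + p(0)` with `q = divX p`, so `q(w) w + p(0) = 0`
  have hsplit : aeval w (divX p) * w + algebraMap ℂ (Module.End ℂ V) (p.coeff 0) = 0 := by
    have h := congrArg (aeval w) (X_mul_divX_add p)
    rw [map_add, mul_comm, map_mul, aeval_X, aeval_C] at h
    rw [h, heval]
  -- `q(w) = Σ_k q_k wᵏ`
  have hq : aeval w (divX p) = ∑ k ∈ Finset.range ((divX p).natDegree + 1), (divX p).coeff k • w ^ k :=
    aeval_eq_sum_range w
  refine ⟨Finset.range ((divX p).natDegree + 1), fun k ↦ -(p.coeff 0)⁻¹ * (divX p).coeff k, ?_⟩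
  have hsum : (∑ k ∈ Finset.range ((divX p).natDegree + 1), (-(p.coeff 0)⁻¹ * (divX p).coeff k) • w ^ k) =
      (-(p.coeff 0)⁻¹) • aeval w (divX p) := by
    rw [hq, Finset.smul_sum]
    exact Finset.sum_congr rfl fun k _ ↦ by rw [mul_smul]
  rw [hsum, LinearMap.smul_comp, ← Module.End.mul_eq_comp, eq_neg_of_add_eq_zero_left hsplit, smul_neg,
    Algebra.algebraMap_eq_smul_one, smul_smul, ← neg_smul, neg_mul, neg_neg, inv_mul_cancel₀ hp0, one_smul,
    Module.End.one_eq_id]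

/-! ## §2 The Lefschetz involution above the middle degree is an algebraic correspondence -/

/-- **`*_L = (L^{g-b})⁻¹ : Hᵃ(A(ℂ); ℂ) → Hᵇ(A(ℂ); ℂ)` (`a > g = dim A`, `b = 2g − a ≥ 2`) is induced by an algebraic
correspondence**, for every complex abelian variety `A` and polarisation class `η` (Kleiman 2A11 / Lieberman): with
`F = [γ_F]_*` the bijective algebraic Fourier correspondence `Hᵃ → Hᵇ` of part XXII-a and `w = F ∘ L^{g-b} = [γ_w]_*`
(part XXII-b), `*_L = (Σ_k d_k wᵏ) ∘ F` for the coefficients of §1, an algebraic correspondence by part XXII-b.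
[cite: Kleiman1968AlgebraicCycles, Appendix to §2, Thm. 2A11] [cite: Lieberman1968, main theorem, pp. 366–374] -/
theorem isAlgebraicCorrespondence_lefschetzInvolution_abelianVariety (A : AbelianVariety ℂ) {η : complexBetti A.X 2}
    (hη : IsPolarizationClass A.dim A.X η) {a b : ℕ} (hab : a + b = 2 * A.dim) (ha : A.dim < a) (hb : 2 ≤ b) :
    IsAlgebraicCorrespondence A.dim A.dim A.X A.X (lefschetzInvolution hη.hasHardLefschetz hab) := by
  have hA : IsSmoothProjective A.dim A.X := AbelianVariety.isSmoothProjective_holds (A := A)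
  set g := A.dim with hg
  have hg1 : 1 ≤ g := by omega
  obtain rfl : a = b + 2 * (g - b) := by omega
  have hL : HasHardLefschetzProperty η g := hη.hasHardLefschetz
  -- the bijective algebraic Fourier correspondence `F : H^{b + 2(g-b)} → Hᵇ`
  have habF : b + 2 * (g - b) + 2 * b = b + 2 * g := by omega
  obtain ⟨γF, hγF, hFbij⟩ := exists_bijective_corrAction A hg1 hη (i := b) (j := b + 2 * (g - b)) (by omega)
  -- `w = F ∘ L^{g-b} = [γ_w]_*`, an automorphism of `Hᵇ`
  have habw : b + 2 * g = b + 2 * g := rfl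
  obtain ⟨γw, hγw, hw⟩ := corrAction_comp_lefschetzPow complexOrientationFamily hA hA hη.mem_algebraicClasses b
    (g - b) (e := b) (e' := g) (by omega) habF habw hγF
  set F := corrAction complexOrientationFamily hA hA habF γF with hFdef
  set w := corrAction complexOrientationFamily hA hA habw γw with hwdef
  have hwL : ∀ x, w x = F (lefschetzPow η (g - b) b x) := hw
  have hLbij : Function.Bijective (lefschetzPow η (g - b) b) := hL (g - b) b (by omega)
  have hwinj : Function.Injective w := by
    intro x x' h
    rw [hwL, hwL] at h
    exact hLbij.1 (hFbij.1 h)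
  -- Cayley–Hamilton: `(Σ d_k w^k) ∘ w = id`
  haveI := finite_complexBetti_abelianVariety A b
  obtain ⟨s, d, hinv⟩ := exists_sum_smul_pow_comp_eq_id w hwinj
  -- `θ = (Σ d_k w^k) ∘ F = [γ_θ]_*`
  obtain ⟨γθ, hγθ, hθ⟩ := exists_corrAction_eq_sum_pow_comp complexOrientationFamily hA hA habF habw hγF hγw s d
  -- `θ = *_L`
  have heq : lefschetzInvolution hη.hasHardLefschetz hab = corrAction complexOrientationFamily hA hA habF γθ := by
    refine LinearMap.ext fun y ↦ ?_
    obtain ⟨x, rfl⟩ := hLbij.2 y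
    rw [lefschetzInvolution_lefschetzPow hL (show b + (g - b) = g by omega) hab x, hθ, LinearMap.comp_apply,
      ← hFdef, ← hwL, ← LinearMap.comp_apply (g := w), hinv, LinearMap.id_apply]
  rw [heq]
  exact isAlgebraicCorrespondence_corrAction complexOrientationFamily hasPoincareDuality_complexOrientationFamily hA hA
    habF (show b + (2 * g - b) = 2 * g by omega) hγθ

/-! ## §3 `B(A)` for every complex abelian variety: Lieberman's theorem, and the named fact discharged -/

/-- **Grothendieck's `B(A)` (André's `⋆_L`-form) for EVERY complex abelian variety `A` and every `η ∈ H²(A(ℂ); ℂ)`**, on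
the real carriers (`StandardConjectureBStar A.dim A.X η`; vacuous unless `η` is a polarisation class): the degrees
`a ≤ g`, `b ≤ 1` are the tree's unconditional ones (`standardConjectureBStar_iff_inverseLefschetz`), the degrees
`a > g`, `b ≥ 2` are §2. [cite: Lieberman1968, main theorem, pp. 366–374] [cite: Kleiman1968AlgebraicCycles, Appendix to §2, Thm. 2A11]
[cite: GreenMurreVoisin1994, Murre §7.7 (p. 123 of the PDF)] -/
theorem standardConjectureBStar_abelianVariety (A : AbelianVariety ℂ) (η : complexBetti A.X 2) :
    StandardConjectureBStar A.dim A.X η :=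
  (standardConjectureBStar_iff_inverseLefschetz (AbelianVariety.isSmoothProjective_holds (A := A)) η).2
    fun hη _ _ hab ha hb ↦ isAlgebraicCorrespondence_lefschetzInvolution_abelianVariety A hη hab ha hb

/-- **DISCHARGE of the named fact `Lieberman1968_lefschetzInvolution_algebraic_abelianVariety`** (Lieberman 1968;
Kleiman 1968 Thm. 2A11): the Literature statement, verbatim, is a theorem of the tree. Net debt of the André axis −1;
the derived Abdulali facts `h₈A`, `h₈` (part XVIII-e `abdulali1994A_of_lieberman`, `abdulali1994_of_lieberman`) follow.
[cite: Lieberman1968, main theorem (B(A)), pp. 366–374] [cite: Kleiman1968AlgebraicCycles, Appendix to §2, Thm. 2A11] -/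
theorem lieberman1968_lefschetzInvolution_algebraic_abelianVariety_holds :
    Lieberman1968_lefschetzInvolution_algebraic_abelianVariety :=
  fun A η ↦ standardConjectureBStar_abelianVariety A η

end Summit.HodgeConjecture.HodgeConjecture.Ring2.AbelianAll

end
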